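import Literature.NumberTheory.PAdicHodge.AinfWeierstrassKummerIntegral
import Literature.NumberTheory.PAdicHodge.AinfWeierstrassQuasiPeriodTwoCocycle
import Literature.NumberTheory.PAdicHodge.AinfWeierstrassEtaPeriodHom
import HarnessLib

/-!
# The η-integrating element `b_η ∈ B_dR⁺(F)` of the Kummer cocycle of a RATIONAL point of `Ŵ`:
# `(σ − 1) b_η = ∫_{κ_u(σ)} η`, and the integrating PAIR `(b_ω, b_η)`

Topic `Literature/NumberTheory/PAdicHodge`; namespace `Literature.NumberTheory.PAdicHodge.AinfTop`. Sequel of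
`AinfWeierstrassKummerIntegral` (the ω-part: `z_u = [ũ] − Q ∈ Ŵ(ker θ)` for a `Γ_F`-fixed lift `Q` of the base point of the
`[p]`-division sequence `u`, `σ z_u = z_u + [κ_u σ]`, `b_ω = log_W(ι z_u)`), of `AinfWeierstrassEtaPeriod{,Add,Hom}` (the
Banach-free η-period `∫_t η = η₀([t]) − ι(corr t)`, `corr t = Σ_{i≥1} p^{i−1}R_p(Tᵢ)`, its `ht0`-FREE additivity
`corr(t ⊕ t') = corr t + corr t' + C([t],[t'])` and equivariance) and of `AinfWeierstrassQuasiPeriodTwoCocycle` (`C` is a 2-cocycle).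
Floor 3 (η-part) of brick K1 «Kummer classes die in `H¹(F, B_dR⁺ ⊗ V_pW)`» of the hT₂ programme of crux K★
`stmt-BirchSwinnertonDyer-22226` (`Cruxes/StarredOptimalManinUnitFiveSeven/Lines/kato-lever-hT2-programme.md` §4 K1).

THE POINT. Colmez's η-integrating element `η₀(ι[ũ]) − ι(corr u)` needs `η₀` at `ι[ũ] ∉ Fil¹`. With the rational constant `Q`
split off (`[ũ] = Q ⊕ z_u`) and `η₀(Q ⊕ z) "=" η₀(Q) + η₀(z) + C(Q, z)`, the `Γ_F`-invariant constant `η₀(Q)` may be dropped: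

  **`b_η := η₀(ι z_u) + ι C(Q, z_u) − ι(corr u)`**   (ξ-adic evaluation on `Fil¹` + two INTEGRAL evaluations in `𝔸_inf`)

and `(σ − 1) b_η = [η₀(ι[κ]) + ιC(z_u,[κ])] + ι[C(Q, z_u ⊕ [κ]) − C(Q, z_u)] − ι[corr κ + C([ũ],[κ])]` (`[κ] = [κ_u σ]`; the
three brackets by `etaKer_add`, `Q = σQ`, and `corr(σu) = corr(u ⊕ κ)`); the 2-cocycle identity
`C(Q ⊕ z_u, [κ]) + C(Q, z_u) = C(Q, z_u ⊕ [κ]) + C(z_u, [κ])` with `Q ⊕ z_u = [ũ]` collapses the cocycle terms: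

  **`σ(b_η) − b_η = η₀(ι[κ_u σ]) − ι(corr κ_u σ) = ∫_{κ_u(σ)} η`**   (`gal_bEta_sub_bEta`).

* §1 `η₀` on `Ŵ(ker θ)` (`etaKer`): `= etaPeriodMain` on torsion sequences, `Γ_F`-equivariance, and the additivity WITH COCYCLE
  `η₀(ι(z + z')) = η₀(ι z) + η₀(ι z') + ι C(z, z')` (`etaKer_add`);
* §2 `σu = u ⊕ κ_u(σ)` termwise (`galSeq_eq_addSeq_kummerSeq`) and **`corr(σu) = corr u + corr κ_u(σ) + C([ũ], [κ_u σ])`**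
  (`etaCorr_galSeq`);
* §3 `bEta` and the coboundary identities `gal_bEta_sub_bEta` (sequence form) / `gal_bEta_sub_bEta_eq_etaPeriodHom`; the
  **integrating pair** `exists_integratingPair_kummerCocycle`: `∃ b_ω b_η, ∀ σ, (σ−1)b_ω = ∫_{κ_u σ} ω ∧ (σ−1)b_η = ∫_{κ_u σ} η`,
  and its `ℚ_p`-rational-base-point corollary `exists_integratingPair_of_zp`.

With the period "matching" of the hDR files this says: the image of the Kummer cocycle `κ_u` in `H¹(Γ_F, B_dR ⊗ V_pŴ)` under the de
Rham comparison is a coboundary; the `Fil⁰` (`B_dR⁺ ⊗ V`) refinement is Bloch–Kato Lemma 3.8.1 (sequel). Definitions (reviewed):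
`etaKer`, `bEta`. No named facts, no `sorry`. BSD / K★ are not proved by any of this.

## References
* S. Bloch, K. Kato, *L-functions and Tamagawa numbers of motives* (1990), Ex. 3.10.1, (3.11.1), Lemma 3.8.1. [BlochKato1990]
* K. Kato, LNM 1553 (1993), Ch. II Lemma 1.4.3. [Kato1993LNM1553]
* P. Colmez, *Périodes p-adiques des variétés abéliennes*, Math. Ann. 292 (1992), §2. [Colmez1992PeriodesAbeliennes]
* J.-M. Fontaine, *Le corps des périodes p-adiques*, Astérisque 223 (1994), Exp. II §1.2.2, §1.5.4. [FontaineAsterisque223III]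
-/

noncomputable section

open Ideal Filter Topology Field WittVector MvPowerSeries

namespace Literature.NumberTheory.PAdicHodge

open Literature.NumberTheory.GaloisRepresentations
open Literature.NumberTheory.GaloisRepresentations.IsNonarchimedeanLocalField
open Literature.NumberTheory.GaloisRepresentations.LubinTate

namespace AinfTop

variable {F : Type} [Field F] [ValuativeRel F] [TopologicalSpace F] [IsNonarchimedeanLocalField F] [CharZero F]
  {p : ℕ} [Fact p.Prime] [Fact (¬ IsUnit (p : integerC F))]
  [IsAdicComplete (Ideal.span {(p : integerC F)}) (integerC F)]
  {hθ : Function.Surjective (fontaineTheta (integerC F) p)}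
  (W : WeierstrassCurve ℤ)

/-! ## §1 `η₀` on `Ŵ(ker θ)` and its additivity with cocycle -/

/-- **`η₀(ι z) ∈ B_dR⁺(F)`** for `z ∈ Ŵ(𝔫)` with `θ(z) = 0`: the quasi-period function evaluated `ξ`-adically at `ι z ∈ Fil¹`.
[cite: Colmez1992PeriodesAbeliennes, §2] [cite: Katz1981CrystallineDieudonne, §5.1] -/
def etaKer (z : W.Pt (nilTheta F p hθ)) (hz : thetaPt W hθ z = 0) : BdRPlusTop F p :=
  (evalPt₁ (BdRPlusTop.filOne F p) (etaSeries W) (constantCoeff_etaSeries W) (kerFil W z hz) : BdRPlusTop F p)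

/-- `etaKer` respects equality of points (and ignores the proof). [cite: Colmez1992PeriodesAbeliennes, §2] -/
theorem etaKer_congr {z z' : W.Pt (nilTheta F p hθ)} (h : z = z') (hz : thetaPt W hθ z = 0) (hz' : thetaPt W hθ z' = 0) :
    etaKer W z hz = etaKer W z' hz' := by subst h; rfl

/-- **`etaKer [τ] = η₀([τ])`** (the main term of `∫_τ η`) for `τ ∈ T_pŴ(𝒪_{ℂ_F})`. [cite: Colmez1992PeriodesAbeliennes, §2] -/
theorem etaKer_torsionLiftHom (τ : TatePt F p W) :
    etaKer W (torsionLiftHom W hθ τ) (thetaPt_torsionLiftHom W τ) = etaPeriodMain W hθ (seq W τ) (seq_zero W τ) (mulPC_seq W τ) := rfl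

/-- `etaKer` of Fontaine's element of a torsion SEQUENCE is the main term of its η-period. [cite: Colmez1992PeriodesAbeliennes, §2] -/
theorem etaKer_divisionLiftPt_of_zero {t : ℕ → (maxNilIdealC F).toIdeal} (ht0 : (t 0 : CBall F) = 0)
    (htp : ∀ n, mulPC F p W (t (n + 1)) = t n) (h : thetaPt W hθ (divisionLiftPt W hθ t htp) = 0) :
    etaKer W (divisionLiftPt W hθ t htp) h = etaPeriodMain W hθ t ht0 htp := rfl

/-- **`Γ_F`-equivariance: `σ(η₀(ι z)) = η₀(ι(σ z))`.** [cite: FontaineAsterisque223III, Exp. II §1.5.4] -/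
theorem gal_etaKer (σ : absoluteGaloisGroup F) (z : W.Pt (nilTheta F p hθ)) (hz : thetaPt W hθ z = 0) :
    BdRPlusTop.gal F p σ (etaKer W z hz) = etaKer W (galPtN W hθ σ z) (thetaPt_galPtN_eq_zero W σ hz) := by
  rw [etaKer, etaKer, BdRPlusTop.gal_evalPt₁]
  congr 2
  exact Subtype.ext (gal_coe_kerFil W σ z hz)

/-- **The cocycle term comes from `𝔸_inf`**: `C₀(ι z, ι z') = ι(C(z, z'))` in `B_dR⁺`, for `z, z' ∈ Ŵ(ker θ)` (integral
coefficients; `𝔸_inf → B_dR⁺` commutes with evaluation at points of `ker θ`). [cite: FontaineAsterisque223III, Exp. II §1.5.2] -/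
theorem coe_evalPt_cocycle_kerFil (z z' : W.Pt (nilTheta F p hθ)) (hz : thetaPt W hθ z = 0) (hz' : thetaPt W hθ z' = 0) :
    (evalPt (BdRPlusTop.filOne F p) (W.map (Int.castRingHom RatCoeff)).formalQuasiPeriodCocycle
        (W.map (Int.castRingHom RatCoeff)).constantCoeff_formalQuasiPeriodCocycle ![kerFil W z hz, kerFil W z' hz'] :
        BdRPlusTop F p) =
      BdRPlusTop.ofAinf F p ((of F p).symm (cocycleAt W hθ z.val z'.val)) := by
  have hCint : (MvPowerSeries.map (Int.castRingHom RatCoeff) (cocycleInt W)).constantCoeff = 0 :=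
    BdRPlusTop.constantCoeff_map_int_eq_zero (constantCoeff_cocycleInt W)
  rw [← congrArg Subtype.val (evalPt_congr (BdRPlusTop.filOne F p) (map_cocycleInt_ratCoeff W) hCint
      (W.map (Int.castRingHom RatCoeff)).constantCoeff_formalQuasiPeriodCocycle ![kerFil W z hz, kerFil W z' hz']),
    ← BdRPlusTop.evalPt_map_int _ (constantCoeff_cocycleInt W) hCint, cocycleAt]
  symm
  exact AinfXiTop.ofAinf_evalPt (cocycleInt W) (constantCoeff_cocycleInt W) _
    (fun i => by
      fin_cases i
      · exact mem_span_xi_of_thetaPt_eq_zero W z hz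
      · exact mem_span_xi_of_thetaPt_eq_zero W z' hz')
    _ (fun i => by fin_cases i <;> rfl)

/-- **Additivity with cocycle: `η₀(ι(z + z')) = η₀(ι z) + η₀(ι z') + ι C(z, z')`** on `Ŵ(ker θ)` (`η₀ ∘ F = η₀(u) + η₀(v) + C₀`
evaluated `ξ`-adically, the cocycle term being integral). [cite: Colmez1992PeriodesAbeliennes, §2] [cite: Katz1981CrystallineDieudonne, §5.1] -/
theorem etaKer_add (z z' : W.Pt (nilTheta F p hθ)) (hz : thetaPt W hθ z = 0) (hz' : thetaPt W hθ z' = 0)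
    (h : thetaPt W hθ (z + z') = 0) :
    etaKer W (z + z') h = etaKer W z hz + etaKer W z' hz' + BdRPlusTop.ofAinf F p ((of F p).symm (cocycleAt W hθ z.val z'.val)) := by
  set V := W.map (Int.castRingHom RatCoeff) with hV
  set T := kerFil W z hz
  set T' := kerFil W z' hz'
  have hFq : (MvPowerSeries.map (Int.castRingHom RatCoeff) W.formalGroupLaw).constantCoeff = 0 :=
    BdRPlusTop.constantCoeff_map_int_eq_zero W.constantCoeff_formalGroupLaw
  -- the point `ι(z + z')` of `Fil¹` is `F_ℚ(T, T')`
  have hpt : kerFil W (z + z') h = evalPt (BdRPlusTop.filOne F p) V.formalGroupLaw V.constantCoeff_formalGroupLaw ![T, T'] := by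
    apply Subtype.ext
    rw [coe_kerFil_add W z z' hz hz' h, BdRPlusTop.evalPt_map_int _ _ hFq]
    exact congrArg Subtype.val (evalPt_congr (BdRPlusTop.filOne F p) (map_formalGroupLaw_ratCoeff W) hFq
      V.constantCoeff_formalGroupLaw ![T, T'])
  have hη0 : PowerSeries.constantCoeff V.formalQuasiPeriod = 0 := V.constantCoeff_formalQuasiPeriod
  have hC0 : V.formalQuasiPeriodCocycle.constantCoeff = 0 := V.constantCoeff_formalQuasiPeriodCocycle
  have hsub0 : (V.formalQuasiPeriod.subst V.formalGroupLaw).constantCoeff = 0 :=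
    constantCoeff_subst_zero (σ := Unit) (fun _ => V.constantCoeff_formalGroupLaw) hη0
  have hX0 : ∀ i : Fin 2, (V.formalQuasiPeriod.subst (MvPowerSeries.X i : MvPowerSeries (Fin 2) RatCoeff)).constantCoeff = 0 :=
    fun i => constantCoeff_subst_zero (σ := Unit) (fun _ => MvPowerSeries.constantCoeff_X i) hη0
  have hsum0 : (V.formalQuasiPeriod.subst (MvPowerSeries.X 0 : MvPowerSeries (Fin 2) RatCoeff) +
      V.formalQuasiPeriod.subst (MvPowerSeries.X 1 : MvPowerSeries (Fin 2) RatCoeff) + V.formalQuasiPeriodCocycle).constantCoeff = 0 := by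
    rw [map_add, map_add, hX0 0, hX0 1, hC0, add_zero, add_zero]
  have hcoc : (evalPt (BdRPlusTop.filOne F p) V.formalQuasiPeriodCocycle hC0 ![T, T'] : BdRPlusTop F p) =
      BdRPlusTop.ofAinf F p ((of F p).symm (cocycleAt W hθ z.val z'.val)) :=
    coe_evalPt_cocycle_kerFil W z z' hz hz'
  rw [etaKer, etaKer, etaKer, hpt]
  have hl : ∀ (x : (BdRPlusTop.filOne F p).toIdeal),
      (evalPt₁ (BdRPlusTop.filOne F p) (etaSeries W) (constantCoeff_etaSeries W) x : BdRPlusTop F p) =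
        evalPt₁ (BdRPlusTop.filOne F p) V.formalQuasiPeriod hη0 x := fun x =>
    congrArg Subtype.val (evalPt_congr (BdRPlusTop.filOne F p) (ι := Unit) (etaSeries_eq_formalQuasiPeriod W)
      (constantCoeff_etaSeries W) hη0 fun _ => x)
  rw [hl, hl, hl, ← evalPt₁_subst (BdRPlusTop.filOne F p) V.formalGroupLaw V.constantCoeff_formalGroupLaw V.formalQuasiPeriod hη0 hsub0,
    evalPt_congr (BdRPlusTop.filOne F p) (formalQuasiPeriod_subst_formalGroupLaw_eq V) hsub0 hsum0 ![T, T'], coe_evalPt, map_add,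
    map_add, ← coe_evalPt (BdRPlusTop.filOne F p) _ (hX0 0), ← coe_evalPt (BdRPlusTop.filOne F p) _ (hX0 1),
    ← coe_evalPt (BdRPlusTop.filOne F p) _ hC0,
    evalPt₁_subst (BdRPlusTop.filOne F p) (MvPowerSeries.X 0 : MvPowerSeries (Fin 2) RatCoeff) (MvPowerSeries.constantCoeff_X 0)
      V.formalQuasiPeriod hη0 (hX0 0),
    evalPt₁_subst (BdRPlusTop.filOne F p) (MvPowerSeries.X 1 : MvPowerSeries (Fin 2) RatCoeff) (MvPowerSeries.constantCoeff_X 1)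
      V.formalQuasiPeriod hη0 (hX0 1), evalPt_X, evalPt_X, hcoc]
  rfl

/-! ## §2 `σu = u ⊕ κ_u(σ)` and the correction of the translated sequence -/

omit [CharZero F] [Fact p.Prime] [Fact (¬ IsUnit (p : integerC F))]
  [IsAdicComplete (Ideal.span {(p : integerC F)}) (integerC F)] in
/-- **`σu = u ⊕ κ_u(σ)` termwise** (`σuₙ = uₙ + (σuₙ − uₙ)` in `Ŵ(𝔪_{ℂ_F})`). [cite: BlochKato1990, Ex. 3.10.1] -/
theorem galSeq_eq_addSeq_kummerSeq (σ : absoluteGaloisGroup F) (u : ℕ → (maxNilIdealC F).toIdeal) :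
    galSeq F σ u = addSeq F W u (kummerSeq W σ u) := by
  funext n
  have h : (σ • (⟨u n⟩ : W.Pt (maxNilIdealC F))) = ⟨u n⟩ + ((σ • (⟨u n⟩ : W.Pt (maxNilIdealC F))) - ⟨u n⟩) :=
    (add_sub_cancel _ _).symm
  exact congrArg WeierstrassCurve.Pt.val h

/-- `ι(σ c) = σ(ι c)` for `ι = (𝔸_inf → B_dR⁺)` in the `AinfTop` dialect. [cite: FontaineAsterisque223III, Exp. II §1.5] -/
theorem gal_ofAinf_symm (σ : absoluteGaloisGroup F) (c : AinfTop F p) :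
    BdRPlusTop.gal F p σ (BdRPlusTop.ofAinf F p ((of F p).symm c)) = BdRPlusTop.ofAinf F p ((of F p).symm (gal F p σ c)) := by
  rw [BdRPlusTop.gal_ofAinf]
  rfl

/-- `C([t], [t'])` along Fontaine's elements of two sequences is the `0`-th term `D₀` of the tree's `cocycleShift`.
[cite: Katz1981CrystallineDieudonne, §5.1] -/
theorem cocycleShift_zero_eq {t t' : ℕ → (maxNilIdealC F).toIdeal} (htp : ∀ n, mulPC F p W (t (n + 1)) = t n)
    (htp' : ∀ n, mulPC F p W (t' (n + 1)) = t' n) :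
    cocycleShift W hθ t t' htp htp' 0 = cocycleAt W hθ (divisionLiftPt W hθ t htp).val (divisionLiftPt W hθ t' htp').val := rfl

/-- **The correction of the translated sequence: `corr(σu) = corr u + corr κ_u(σ) + C([ũ], [κ_u σ])`** (`σu = u ⊕ κ_u σ` and the
`ht0`-free additivity `etaCorr_addSeq`). [cite: Colmez1992PeriodesAbeliennes, §2] [cite: BlochKato1990, Ex. 3.10.1] -/
theorem etaCorr_galSeq (σ : absoluteGaloisGroup F) {u : ℕ → (maxNilIdealC F).toIdeal} (hup : ∀ n, mulPC F p W (u (n + 1)) = u n) :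
    etaCorr W hθ (galSeq F σ u) (mulPC_galSeq W hθ σ hup) =
      etaCorr W hθ u hup + etaCorr W hθ (kummerSeq W σ u) (mulPC_kummerSeq W σ hup) +
        cocycleAt W hθ (divisionLiftPt W hθ u hup).val (divisionLiftPt W hθ (kummerSeq W σ u) (mulPC_kummerSeq W σ hup)).val := by
  have h := etaCorr_addSeq W (hθ := hθ) hup (mulPC_kummerSeq W σ hup)
  rw [etaCorr_congr_seq W (galSeq_eq_addSeq_kummerSeq W σ u) (mulPC_galSeq W hθ σ hup)
      (mulPC_addSeq W hup (mulPC_kummerSeq W σ hup)), ← cocycleShift_zero_eq W hup (mulPC_kummerSeq W σ hup)]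
  linear_combination h

/-! ## §3 The η-integrating element and the integrating pair -/

section Kummer

variable {u : ℕ → (maxNilIdealC F).toIdeal} (hup : ∀ n, mulPC F p W (u (n + 1)) = u n)
  {Q : W.Pt (nilTheta F p hθ)}

/-- **The η-integrating element `b_η := η₀(ι z_u) + ι C(Q, z_u) − ι(corr u) ∈ B_dR⁺(F)`** of the Kummer cocycle of the
division sequence `u` relative to the fixed lift `Q` of its base point. [cite: BlochKato1990, Ex. 3.10.1] [cite: Colmez1992PeriodesAbeliennes, §2] -/
def bEta (hup : ∀ n, mulPC F p W (u (n + 1)) = u n) (hQ : thetaPt W hθ Q = ⟨u 0⟩) : BdRPlusTop F p :=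
  etaKer W (kummerIntegralPt W hup Q) (thetaPt_kummerIntegralPt W hup hQ) +
      BdRPlusTop.ofAinf F p ((of F p).symm (cocycleAt W hθ Q.val (kummerIntegralPt W hup Q).val)) -
    BdRPlusTop.ofAinf F p ((of F p).symm (etaCorr W hθ u hup))

/-- `Q + z_u = [ũ]` in `Ŵ(𝔫)`. [cite: FontaineAsterisque223III, Exp. II §1.2.2] -/
theorem add_kummerIntegralPt (Q : W.Pt (nilTheta F p hθ)) : Q + kummerIntegralPt W hup Q = divisionLiftPt W hθ u hup := by
  rw [kummerIntegralPt_def, add_sub_cancel]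

/-- **THE COBOUNDARY IDENTITY `σ(b_η) − b_η = ∫_{κ_u(σ)} η`** (sequence form). [cite: BlochKato1990, Ex. 3.10.1]
[cite: Kato1993LNM1553, Ch. II Lemma 1.4.3] [cite: Colmez1992PeriodesAbeliennes, §2] -/
theorem gal_bEta_sub_bEta (hQ : thetaPt W hθ Q = ⟨u 0⟩) (hQσ : ∀ σ : absoluteGaloisGroup F, galPtN W hθ σ Q = Q)
    (σ : absoluteGaloisGroup F) :
    BdRPlusTop.gal F p σ (bEta W hup hQ) - bEta W hup hQ =
      etaPeriod W hθ (kummerSeq W σ u) (coe_kummerSeq_zero W σ (galCBall_base_eq_of_fixedLift W hQ hQσ σ))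
        (mulPC_kummerSeq W σ hup) := by
  -- names: `z = z_u`, `k = [κ_u σ]`
  have hz : thetaPt W hθ (kummerIntegralPt W hup Q) = 0 := thetaPt_kummerIntegralPt W hup hQ
  have hk : thetaPt W hθ (divisionLiftPt W hθ (kummerSeq W σ u) (mulPC_kummerSeq W σ hup)) = 0 :=
    thetaPt_divisionLiftPt_kummerSeq W hup hQ hQσ σ
  have hσz := galPtN_kummerIntegralPt W hup hQσ σ
  -- (1) the main term
  have E1 : BdRPlusTop.gal F p σ (etaKer W (kummerIntegralPt W hup Q) hz) =
      etaKer W (kummerIntegralPt W hup Q) hz +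
        etaKer W (divisionLiftPt W hθ (kummerSeq W σ u) (mulPC_kummerSeq W σ hup)) hk +
        BdRPlusTop.ofAinf F p ((of F p).symm (cocycleAt W hθ (kummerIntegralPt W hup Q).val
          (divisionLiftPt W hθ (kummerSeq W σ u) (mulPC_kummerSeq W σ hup)).val)) := by
    rw [gal_etaKer, etaKer_congr W hσz _ (thetaPt_add_eq_zero W hz hk), etaKer_add W _ _ hz hk]
  -- (2) the constant's cocycle term
  have E2 : BdRPlusTop.gal F p σ (BdRPlusTop.ofAinf F p ((of F p).symm (cocycleAt W hθ Q.val (kummerIntegralPt W hup Q).val))) =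
      BdRPlusTop.ofAinf F p ((of F p).symm (cocycleAt W hθ Q.val
        (kummerIntegralPt W hup Q + divisionLiftPt W hθ (kummerSeq W σ u) (mulPC_kummerSeq W σ hup)).val)) := by
    rw [gal_ofAinf_symm, gal_cocycleAt]
    have hQ' : (⟨gal F p σ (Q.val : AinfTop F p), gal_mem_nilTheta σ Q.val.2⟩ : (nilTheta F p hθ).toIdeal) = Q.val :=
      congrArg WeierstrassCurve.Pt.val (hQσ σ)
    have hz' : (⟨gal F p σ ((kummerIntegralPt W hup Q).val : AinfTop F p), gal_mem_nilTheta σ (kummerIntegralPt W hup Q).val.2⟩ :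
        (nilTheta F p hθ).toIdeal) =
        (kummerIntegralPt W hup Q + divisionLiftPt W hθ (kummerSeq W σ u) (mulPC_kummerSeq W σ hup)).val :=
      congrArg WeierstrassCurve.Pt.val hσz
    rw [hQ', hz']
  -- (3) the correction
  have E3 : BdRPlusTop.gal F p σ (BdRPlusTop.ofAinf F p ((of F p).symm (etaCorr W hθ u hup))) =
      BdRPlusTop.ofAinf F p ((of F p).symm (etaCorr W hθ u hup + etaCorr W hθ (kummerSeq W σ u) (mulPC_kummerSeq W σ hup) +
        cocycleAt W hθ (divisionLiftPt W hθ u hup).val (divisionLiftPt W hθ (kummerSeq W σ u) (mulPC_kummerSeq W σ hup)).val)) := by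
    rw [gal_ofAinf_symm, gal_etaCorr W σ hup, etaCorr_galSeq W σ hup]
  -- (4) the 2-cocycle identity with `Q ⊕ z_u = [ũ]`
  have h2c := cocycleAt_two_cocycle W (hθ := hθ) Q.val (kummerIntegralPt W hup Q).val
    (divisionLiftPt W hθ (kummerSeq W σ u) (mulPC_kummerSeq W σ hup)).val
  rw [← val_add_N, ← val_add_N, add_kummerIntegralPt W hup Q] at h2c
  have hj := congrArg (fun c : AinfTop F p => BdRPlusTop.ofAinf F p ((of F p).symm c)) h2c
  simp only [map_add] at hj
  rw [bEta, map_sub, map_add, E1, E2, E3, etaPeriod, ← etaKer_divisionLiftPt_of_zero W _ _ hk]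
  simp only [map_add]
  linear_combination -hj

/-- **THE COBOUNDARY IDENTITY, Tate-module form: `σ(b_η) − b_η = etaPeriodHom (kummerCocycle u σ)`.**
[cite: BlochKato1990, Ex. 3.10.1] [cite: Kato1993LNM1553, Ch. II Lemma 1.4.3] -/
theorem gal_bEta_sub_bEta_eq_etaPeriodHom (hQ : thetaPt W hθ Q = ⟨u 0⟩)
    (hQσ : ∀ σ : absoluteGaloisGroup F, galPtN W hθ σ Q = Q) (σ : absoluteGaloisGroup F) :
    BdRPlusTop.gal F p σ (bEta W hup hQ) - bEta W hup hQ =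
      etaPeriodHom W hθ (kummerCocycle W u hup (galCBall_base_eq_of_fixedLift W hQ hQσ) σ) := by
  rw [gal_bEta_sub_bEta W hup hQ hQσ σ, etaPeriodHom_apply]
  rfl

/-- **Brick K1, floor 3: the INTEGRATING PAIR of the Kummer cocycle of a division sequence with a `Γ_F`-fixed lift of its base
point** — `∃ b_ω, b_η ∈ B_dR⁺(F)` with `(σ−1) b_ω = ∫_{κ_u σ} ω` and `(σ−1) b_η = ∫_{κ_u σ} η` for all `σ ∈ Γ_F`: the image of
`κ_u` under the two period maps of `T_pŴ` is a Galois coboundary. [cite: BlochKato1990, Ex. 3.10.1, (3.11.1)]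
[cite: Kato1993LNM1553, Ch. II Lemma 1.4.3] -/
theorem exists_integratingPair_kummerCocycle (hQ : thetaPt W hθ Q = ⟨u 0⟩)
    (hQσ : ∀ σ : absoluteGaloisGroup F, galPtN W hθ σ Q = Q) :
    ∃ bω bη : BdRPlusTop F p, bω ∈ (BdRPlusTop.filOne F p).toIdeal ∧ ∀ σ : absoluteGaloisGroup F,
      BdRPlusTop.gal F p σ bω - bω = omegaPeriodHom W hθ (kummerCocycle W u hup (galCBall_base_eq_of_fixedLift W hQ hQσ) σ) ∧
        BdRPlusTop.gal F p σ bη - bη = etaPeriodHom W hθ (kummerCocycle W u hup (galCBall_base_eq_of_fixedLift W hQ hQσ) σ) :=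
  ⟨bOmega W hup hQ, bEta W hup hQ, bOmega_mem_filOne W hup hQ, fun σ =>
    ⟨gal_bOmega_sub_bOmega_eq_omegaPeriodHom W hup hQ hQσ σ, gal_bEta_sub_bEta_eq_etaPeriodHom W hup hQ hQσ σ⟩⟩

end Kummer

/-- **Brick K1, floor 3, for `ℚ_p`-rational base points**: a `[p]`-division sequence `u` in `Ŵ(𝔪_{ℂ_F})` whose base point has
parameter `p·c`, `c ∈ ℤ_p`, has an integrating pair `(b_ω, b_η)` in `B_dR⁺(F)` for BOTH periods of its Kummer cocycle.
[cite: BlochKato1990, Ex. 3.10.1, (3.11.1)] [cite: Kato1993LNM1553, Ch. II Lemma 1.4.3] -/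
theorem exists_integratingPair_of_zp {u : ℕ → (maxNilIdealC F).toIdeal} (hup : ∀ n, mulPC F p W (u (n + 1)) = u n)
    (c : ℤ_[p]) (hu0 : (u 0 : CBall F) = theta F p (of F p (zpToAinf ((p : ℤ_[p]) * c)))) :
    ∃ hu₀ : ∀ σ : absoluteGaloisGroup F, galCBall σ (u 0 : CBall F) = u 0,
      ∃ bω bη : BdRPlusTop F p, bω ∈ (BdRPlusTop.filOne F p).toIdeal ∧ ∀ σ : absoluteGaloisGroup F,
        BdRPlusTop.gal F p σ bω - bω = omegaPeriodHom W hθ (kummerCocycle W u hup hu₀ σ) ∧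
          BdRPlusTop.gal F p σ bη - bη = etaPeriodHom W hθ (kummerCocycle W u hup hu₀ σ) := by
  have hQ : thetaPt W hθ (zpPt W hθ c) = ⟨u 0⟩ :=
    WeierstrassCurve.Pt.ext (Subtype.ext (by rw [coe_val_thetaPt, coe_val_zpPt, hu0]))
  exact ⟨galCBall_base_eq_of_fixedLift W hQ fun σ => galPtN_zpPt W σ c,
    exists_integratingPair_kummerCocycle W hup hQ fun σ => galPtN_zpPt W σ c⟩

end AinfTop

end Literature.NumberTheory.PAdicHodge

end
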